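import Literature.Probability.RandomPlanarGeometry.SAWPulledRenewalIdentity
import Literature.Probability.RandomPlanarGeometry.SAWIrreducibleBridgeCrossings
import Literature.Probability.RandomPlanarGeometry.SAWFiniteMemory18At2688
import Literature.Probability.RandomPlanarGeometry.SAWBridgeUpperBound
import HarnessLib

/-!
# The span envelope of the pulled block weights (lane «pcv-sawmu», route R35 «PULL-GAP», item R35.3)

Topic `Literature/Probability/RandomPlanarGeometry` (continues `SAWPulledRenewalIdentity.lean`: `Zd.pulledIrrZ`,
`Zd.pulledIrrZ₂`, `Zd.pulledBlockLaw`, `Zd.pulledIrrZ_sub_pulledIrrZ₂`; `SAWIrreducibleBridgeCrossings.lean`: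
`Zd.three_mul_span_le`; `SAWPulledBridgeFreeEnergy.lean`: `Zd.pulledBridgeFreeEnergy` = `λ_B(y)`).

Source for the mechanism: N. Madras, G. Slade, *The Self-Avoiding Walk* (1993; 2013 reprint pagination), §4.2,
p. 94, remark after Theorem 4.2.4 and eqs. (4.2.21)–(4.2.22) (held scan `book:madras1993-self-avoiding-walk`
p0109:L47–59): "an irreducible bridge of span `L ≥ 2` must have at least `3L` steps", whence
`A_z(L) ≤ Σ_{N ≥ 3L} b_N z^N ≤ (μz)^{3L}/(1 - μz)` — the mass of irreducible bridges read along the SPAN axis of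
the two-variable generating function. Here the same three-crossings input (`three_mul_span_le`, `3A ≤ k + 2`) is
read along the LENGTH axis at positive force `y ≥ 1`: an irreducible `i`-step bridge of span `A ≥ 2` has weight
`y^A ≤ y^{(i+2)/3}`, there are at most `b_i ≤ μ^i ≤ 2.688^i` of them (`Zd.connectiveConstant_two_le_2688`), and
`e^{-iλ_B(y)} ≤ L^{-i}` for any certified `L ≤ e^{λ_B(y)}`.

## What is proved (not in print in this form; `ℤ²`)
* `pulledIrrZ₂_mul_exp_le` (R35.3): for `y ≥ 1`, `0 < L`, `log L ≤ λ_B(y)` and every `i`,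
  `pulledIrrZ₂ 2 i y · e^{-iλ_B(y)} ≤ y^{2/3} · (2.688 · y^{1/3}/L)^i` — the span-`≥ 2` part of the pulled block
  weight decays geometrically with ratio `q(y) = 2.688 y^{1/3}/L_y` (`< 1` for the lane's certified tilts
  `y ≥ 25/16`);
* `pulledBlockLaw_le_envelope`: for `i ≥ 2`, `p_i(y) = Λ_i(y) e^{-iλ_B(y)} ≤ 2y·L^{-i} + y^{2/3} q(y)^i` (adding the
  span-`1` part `Λ_i - Λ_i^{(≥2)} = 2y`, `Zd.pulledIrrZ_sub_pulledIrrZ₂`).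
Text: a-p2 g2's lane draft `R35_3_SpanEnvelope.lean` (there conditional on R35.1 as hypothesis `h351`), with `h351`
discharged by `Zd.three_mul_span_le` and the objects taken from `SAWPulledRenewalIdentity.lean`. Guard rows
P-R35-1 / P-R35-3 of the lane's PREREG Am. U signed on the ℤ² census before filing. Tree-twin search: stems
`pulledIrrZ₂_mul_exp`, `span2_envelope`, `pulledBlockLaw_le` → none outside the two files imported. No twin.
-/

noncomputable section

open Finset Filter Topology
open scoped BigOperators
open Literature.Probability.LatticeModels Literature.Probability.Percolation

namespace Literature.Probability.RandomPlanarGeometry.SAW.Zd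

/-- `e^{-iΛ} ≤ L^{-i}` when `log L ≤ Λ` and `L > 0`. [folklore] -/
private theorem exp_neg_mul_le_inv_pow {L Λ : ℝ} (hL : 0 < L) (hLB : Real.log L ≤ Λ) (i : ℕ) :
    Real.exp (-(i : ℝ) * Λ) ≤ (L ^ i)⁻¹ := by
  have h1 : L ^ i ≤ Real.exp ((i : ℝ) * Λ) := by
    calc L ^ i = Real.exp (Real.log L) ^ i := by rw [Real.exp_log hL]
      _ = Real.exp ((i : ℝ) * Real.log L) := by rw [← Real.exp_nat_mul]
      _ ≤ Real.exp ((i : ℝ) * Λ) := Real.exp_le_exp.2 (mul_le_mul_of_nonneg_left hLB (Nat.cast_nonneg _))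
  rw [show -(i : ℝ) * Λ = -((i : ℝ) * Λ) by ring, Real.exp_neg]
  exact inv_anti₀ (pow_pos hL i) h1

/-- **R35.3 — the span-`≥ 2` envelope.** For `y ≥ 1`, `L > 0` with `log L ≤ λ_B(y)` and every `i`,
`pulledIrrZ₂ 2 i y · e^{-iλ_B(y)} ≤ y^{2/3} (2.688 · y^{1/3}/L)^i`: termwise `y^A ≤ y^{(i+2)/3}` by the
three-crossings lemma `3A ≤ i + 2` (`Zd.three_mul_span_le`), `#Λ_i^{(≥2)} ≤ λ_i ≤ b_i ≤ μ^i ≤ 2.688^i`, and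
`e^{-iλ_B} ≤ L^{-i}`. [cite: MadrasSlade1993, §4.2, remark after Theorem 4.2.4 and eqs. (4.2.21)–(4.2.22) (p. 94) (mechanism; positive-force form derived)] -/
theorem pulledIrrZ₂_mul_exp_le (i : ℕ) {y L : ℝ} (hy : 1 ≤ y) (hL : 0 < L)
    (hLB : Real.log L ≤ pulledBridgeFreeEnergy 2 y) :
    pulledIrrZ₂ 2 i y * Real.exp (-(i : ℝ) * pulledBridgeFreeEnergy 2 y)
      ≤ y ^ (2 / 3 : ℝ) * (2.688 * y ^ (1 / 3 : ℝ) / L) ^ i := by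
  classical
  have hy0 : 0 < y := by linarith
  -- termwise: `y^{span} ≤ y^{(i+2)/3} = y^{2/3} (y^{1/3})^i`
  set Y : ℝ := y ^ (2 / 3 : ℝ) * (y ^ (1 / 3 : ℝ)) ^ i with hY
  have hY0 : 0 ≤ Y := by positivity
  have hterm : ∀ ω ∈ (irreducibleBridges 2 i).filter (fun ω => (2 : ℤ) ≤ ω i 0),
      y ^ (ω i 0).toNat ≤ Y := by
    intro ω hω
    rw [Finset.mem_filter] at hω
    have h3 := three_mul_span_le hω.1
    have hy3 : 1 ≤ y ^ (1 / 3 : ℝ) := Real.one_le_rpow hy (by norm_num)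
    have e1 : y ^ (ω i 0).toNat = (y ^ (1 / 3 : ℝ)) ^ (3 * (ω i 0).toNat) := by
      rw [pow_mul, ← Real.rpow_natCast (y ^ (1 / 3 : ℝ)) 3, ← Real.rpow_mul hy0.le]
      norm_num
    have e2 : Y = (y ^ (1 / 3 : ℝ)) ^ (i + 2) := by
      rw [hY, pow_add, mul_comm, ← Real.rpow_natCast (y ^ (1 / 3 : ℝ)) 2, ← Real.rpow_mul hy0.le]
      norm_num
    rw [e1, e2]
    exact pow_le_pow_right₀ hy3 h3
  -- sum: `pulledIrrZ₂ ≤ #filter · Y ≤ λ_i · Y ≤ b_i · Y ≤ μ^i Y ≤ 2.688^i Y`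
  have hsum : pulledIrrZ₂ 2 i y ≤ (2.688 : ℝ) ^ i * Y := by
    unfold pulledIrrZ₂
    calc ∑ ω ∈ (irreducibleBridges 2 i).filter (fun ω => (2 : ℤ) ≤ ω i 0), y ^ (ω i 0).toNat
        ≤ ∑ ω ∈ (irreducibleBridges 2 i).filter (fun ω => (2 : ℤ) ≤ ω i 0), Y := Finset.sum_le_sum hterm
      _ = (((irreducibleBridges 2 i).filter (fun ω => (2 : ℤ) ≤ ω i 0)).card : ℝ) * Y := by
          rw [Finset.sum_const, nsmul_eq_mul]
      _ ≤ (bridgeCount 2 i : ℝ) * Y := by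
          apply mul_le_mul_of_nonneg_right _ hY0
          exact_mod_cast (Finset.card_filter_le _ _).trans (irreducibleBridgeCount_le_bridgeCount (d := 2) i)
      _ ≤ connectiveConstant 2 ^ i * Y := mul_le_mul_of_nonneg_right (bridgeCount_le_pow (d := 2) i) hY0
      _ ≤ (2.688 : ℝ) ^ i * Y := by
          apply mul_le_mul_of_nonneg_right _ hY0
          exact pow_le_pow_left₀ (connectiveConstant_pos 2).le connectiveConstant_two_le_2688 i
  have hexp := exp_neg_mul_le_inv_pow hL hLB i
  have hexp0 : 0 ≤ Real.exp (-(i : ℝ) * pulledBridgeFreeEnergy 2 y) := (Real.exp_pos _).le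
  have h0 : 0 ≤ pulledIrrZ₂ 2 i y := by
    unfold pulledIrrZ₂; exact Finset.sum_nonneg fun ω _ => pow_nonneg hy0.le _
  calc pulledIrrZ₂ 2 i y * Real.exp (-(i : ℝ) * pulledBridgeFreeEnergy 2 y)
      ≤ ((2.688 : ℝ) ^ i * Y) * (L ^ i)⁻¹ := mul_le_mul hsum hexp hexp0 (by positivity)
    _ = y ^ (2 / 3 : ℝ) * (2.688 * y ^ (1 / 3 : ℝ) / L) ^ i := by
        rw [hY, div_pow, mul_pow]; field_simp

/-- **Whole block-weight envelope.** For `i ≥ 2`, `y ≥ 1`, `0 < L`, `log L ≤ λ_B(y)`: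
`p_i(y) = Λ_i(y) e^{-iλ_B(y)} ≤ 2y · L^{-i} + y^{2/3} (2.688 y^{1/3}/L)^i` (the span-`1` part of `Λ_i` is exactly
`2y` on `ℤ²`, `Zd.pulledIrrZ_sub_pulledIrrZ₂`). [cite: MadrasSlade1993, §4.2, remark after Theorem 4.2.4 and eqs. (4.2.21)–(4.2.22) (p. 94) (mechanism; positive-force form derived)] -/
theorem pulledBlockLaw_le_envelope (i : ℕ) (hi : 2 ≤ i) {y L : ℝ} (hy : 1 ≤ y) (hL : 0 < L)
    (hLB : Real.log L ≤ pulledBridgeFreeEnergy 2 y) :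
    pulledBlockLaw 2 y i ≤ 2 * y * (L ^ i)⁻¹ + y ^ (2 / 3 : ℝ) * (2.688 * y ^ (1 / 3 : ℝ) / L) ^ i := by
  have h2 := pulledIrrZ₂_mul_exp_le i hy hL hLB
  have h1 : pulledIrrZ 2 i y - pulledIrrZ₂ 2 i y = 2 * y := pulledIrrZ_sub_pulledIrrZ₂ i hi y
  have hexp := exp_neg_mul_le_inv_pow hL hLB i
  have hexp0 : 0 ≤ Real.exp (-(i : ℝ) * pulledBridgeFreeEnergy 2 y) := (Real.exp_pos _).le
  have hsplit : pulledIrrZ 2 i y = (pulledIrrZ 2 i y - pulledIrrZ₂ 2 i y) + pulledIrrZ₂ 2 i y := by ring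
  unfold pulledBlockLaw
  rw [hsplit, add_mul, h1]
  have : 2 * y * Real.exp (-(i : ℝ) * pulledBridgeFreeEnergy 2 y) ≤ 2 * y * (L ^ i)⁻¹ :=
    mul_le_mul_of_nonneg_left hexp (by linarith)
  linarith

end Literature.Probability.RandomPlanarGeometry.SAW.Zd

end
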